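import Mathlib
import Literature.Analysis.FunctionSpaces.NuclearSpace
import Literature.MathematicalPhysics.QuantumManyBody.BoseEinsteinCondensation

/-!
# Crux `ParticleTensorisation` (stmt-AtomisticToContinuum-14367) — `Negative/`:
# the positive-type kernel that hides a mean-field ferromagnet (file K)

Toward `¬ stub_posdefDressing` (line `registered` / birth-posdef-undressing of the crux, dead):
the one-parameter family of pair kernels on `ℝ³`
`U y = (u/(N-1)) ∑_{m=1}^{N-1} cos(2π(y₀ + m y₁))`
is continuous, even, bounded by `u`, and Bochner positive definite (each Hermitian form is
`(u/2(N-1)) ∑_m (|∑_j c_j e^{iθ_m(x_j)}|² + |∑_j c_j e^{-iθ_m(x_j)}|²)` because the phases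
`θ_m(y) = 2π(y₀ + m y₁)` are LINEAR), while the discrete Fourier identity
`∑_{m=1}^{N-1} cos(2π m d/N) = -1` (`0 < |d| < N`) makes it equal to `-ε·u/(N-1) + O(N a)` at
differences of points of two wells at heights `d/N` apart and horizontal offset `c₀ ∈ {0, ±½}`
(`ε = cos(2πc₀) = ±1`): on such wells `∑_{k<l} U(x_k - x_l)` is the Curie–Weiss energy.
Everything is stated for an abstract `U` with its defining equation as a hypothesis (`hU`), in
the style of the `JastrowDobrushin` helper files (no auxiliary definitions).
-/

noncomputable section

open scoped BigOperators ComplexConjugate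
open Finset

namespace Summit.AtomisticToContinuum.BoseEinsteinCondensation.Theorems.PosdefDressingNeg

open Literature.MathematicalPhysics.QuantumManyBody.BoseGas (Space)

variable {N : ℕ} {u : ℝ} {U : Space → ℝ}

/-- The phase `θ_m(y) = 2π (y₀ + (m+1) y₁)` is additive in `y` (it is linear). [folklore] -/
theorem phase_sub (m : ℕ) (y y' : Space) :
    2 * Real.pi * ((y - y') 0 + (m + 1 : ℝ) * (y - y') 1) =
      2 * Real.pi * (y 0 + (m + 1 : ℝ) * y 1) - 2 * Real.pi * (y' 0 + (m + 1 : ℝ) * y' 1) := by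
  simp only [PiLp.sub_apply]
  ring

/-- `U` is continuous. [folklore] -/
theorem continuous_U
    (hU : ∀ y, U y = u / ((N : ℝ) - 1) *
      ∑ m ∈ range (N - 1), Real.cos (2 * Real.pi * (y 0 + (m + 1 : ℝ) * y 1))) :
    Continuous U := by
  have h : U = fun y => u / ((N : ℝ) - 1) *
      ∑ m ∈ range (N - 1), Real.cos (2 * Real.pi * (y 0 + (m + 1 : ℝ) * y 1)) := funext hU
  rw [h]
  fun_prop

/-- `U` is even. [folklore] -/
theorem U_neg
    (hU : ∀ y, U y = u / ((N : ℝ) - 1) *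
      ∑ m ∈ range (N - 1), Real.cos (2 * Real.pi * (y 0 + (m + 1 : ℝ) * y 1))) (y : Space) :
    U (-y) = U y := by
  rw [hU, hU]
  congr 1
  refine sum_congr rfl fun m _ => ?_
  rw [show 2 * Real.pi * ((-y) 0 + (m + 1 : ℝ) * (-y) 1) =
      -(2 * Real.pi * (y 0 + (m + 1 : ℝ) * y 1)) by simp only [PiLp.neg_apply]; ring,
    Real.cos_neg]

/-- `|U| ≤ u` for `u ≥ 0`. [folklore] -/
theorem abs_U_le (hu : 0 ≤ u)
    (hU : ∀ y, U y = u / ((N : ℝ) - 1) *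
      ∑ m ∈ range (N - 1), Real.cos (2 * Real.pi * (y 0 + (m + 1 : ℝ) * y 1))) (y : Space) :
    |U y| ≤ u := by
  rw [hU]
  rcases Nat.lt_or_ge N 2 with hN | hN
  · interval_cases N <;> simp [hu]
  have hN1 : (0 : ℝ) < (N : ℝ) - 1 := by
    have : (2 : ℝ) ≤ N := by exact_mod_cast hN
    linarith
  rw [abs_mul, abs_div, abs_of_nonneg hu, abs_of_pos hN1]
  have hs : |∑ m ∈ range (N - 1), Real.cos (2 * Real.pi * (y 0 + (m + 1 : ℝ) * y 1))| ≤
      (N : ℝ) - 1 := by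
    refine (abs_sum_le_sum_abs _ _).trans ?_
    calc ∑ m ∈ range (N - 1), |Real.cos (2 * Real.pi * (y 0 + (m + 1 : ℝ) * y 1))|
        ≤ ∑ _m ∈ range (N - 1), (1 : ℝ) := sum_le_sum fun m _ => Real.abs_cos_le_one _
      _ = (N : ℝ) - 1 := by
          rw [sum_const, card_range, nsmul_eq_mul, mul_one, Nat.cast_sub (by omega)]
          simp
  calc u / ((N : ℝ) - 1) * |∑ m ∈ range (N - 1), Real.cos (2 * Real.pi * (y 0 + (m + 1 : ℝ) * y 1))|
      ≤ u / ((N : ℝ) - 1) * ((N : ℝ) - 1) := by gcongr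
    _ = u := by field_simp

/-- Complex conjugation of a unimodular exponential. [folklore] -/
theorem conj_exp_mul_I (t : ℝ) :
    conj (Complex.exp (t * Complex.I)) = Complex.exp (-(t * Complex.I)) := by
  rw [← Complex.exp_conj, map_mul, Complex.conj_ofReal, Complex.conj_I]
  congr 1
  ring

/-- The Hermitian form of `cos(a_j - a_i)` is a sum of two squared moduli:
`∑ᵢⱼ c̄ᵢ cⱼ cos(aⱼ - aᵢ) = (|∑ⱼ cⱼ e^{i aⱼ}|² + |∑ⱼ cⱼ e^{-i aⱼ}|²)/2`. [folklore] -/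
theorem sum_sum_conj_mul_cos_sub {n : ℕ} (a : Fin n → ℝ) (c : Fin n → ℂ) :
    ∑ i, ∑ j, conj (c i) * c j * (Real.cos (a j - a i) : ℂ) =
      ((Complex.normSq (∑ j, c j * Complex.exp (a j * Complex.I)) +
        Complex.normSq (∑ j, c j * conj (Complex.exp (a j * Complex.I)))) / 2 : ℝ) := by
  set e : Fin n → ℂ := fun j => Complex.exp (a j * Complex.I) with he
  have hcos : ∀ i j, (Real.cos (a j - a i) : ℂ) = (e j * conj (e i) + conj (e j) * e i) / 2 := by
    intro i j
    simp only [he]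
    rw [conj_exp_mul_I, conj_exp_mul_I, ← Complex.exp_add, ← Complex.exp_add, Complex.ofReal_cos,
      Complex.cos]
    congr 2 <;> (congr 1; push_cast; ring)
  have h1 : ∀ (f : Fin n → ℂ), ∑ i, ∑ j, conj (c i) * c j * (f j * conj (f i)) =
      (∑ j, c j * f j) * conj (∑ j, c j * f j) := by
    intro f
    rw [map_sum, sum_mul_sum, sum_comm]
    refine sum_congr rfl fun i _ => sum_congr rfl fun j _ => ?_
    rw [map_mul]; ring
  have h2 : ∑ i, ∑ j, conj (c i) * c j * (conj (e j) * e i) =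
      (∑ j, c j * conj (e j)) * conj (∑ j, c j * conj (e j)) := by
    rw [← h1 fun j => conj (e j)]
    simp only [Complex.conj_conj]
  simp_rw [hcos]
  have hsplit : ∑ i, ∑ j, conj (c i) * c j * ((e j * conj (e i) + conj (e j) * e i) / 2) =
      ((∑ i, ∑ j, conj (c i) * c j * (e j * conj (e i))) +
        ∑ i, ∑ j, conj (c i) * c j * (conj (e j) * e i)) / 2 := by
    rw [← sum_add_distrib, sum_div]
    refine sum_congr rfl fun i _ => ?_
    rw [← sum_add_distrib, sum_div]
    refine sum_congr rfl fun j _ => ?_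
    ring
  rw [hsplit, h1, h2, Complex.mul_conj, Complex.mul_conj]
  push_cast
  ring

/-- `U` is positive definite in Bochner's sense (the tree's `IsPositiveDefinite`): a
nonnegative combination of cosines of LINEAR phases. [folklore] -/
theorem isPositiveDefinite_U (hu : 0 ≤ u) (hN : 2 ≤ N)
    (hU : ∀ y, U y = u / ((N : ℝ) - 1) *
      ∑ m ∈ range (N - 1), Real.cos (2 * Real.pi * (y 0 + (m + 1 : ℝ) * y 1))) :
    Literature.Analysis.FunctionSpaces.IsPositiveDefinite (fun y => (U y : ℂ)) := by
  intro n x c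
  have hN1 : (0 : ℝ) < (N : ℝ) - 1 := by
    have : (2 : ℝ) ≤ N := by exact_mod_cast hN
    linarith
  set κ : ℝ := u / ((N : ℝ) - 1) with hκ
  have hκ0 : 0 ≤ κ := div_nonneg hu hN1.le
  -- rewrite the Hermitian form as a real nonnegative number
  set a : ℕ → Fin n → ℝ := fun m i => 2 * Real.pi * (x i 0 + (m + 1 : ℝ) * x i 1) with ha
  have key : ∑ i, ∑ j, conj (c i) * c j * (U (x j - x i) : ℂ) =
      ((κ * ∑ m ∈ range (N - 1),
        (Complex.normSq (∑ j, c j * Complex.exp (a m j * Complex.I)) +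
          Complex.normSq (∑ j, c j * conj (Complex.exp (a m j * Complex.I)))) / 2 : ℝ) : ℂ) := by
    have hUij : ∀ i j, (U (x j - x i) : ℂ) =
        (κ : ℂ) * ∑ m ∈ range (N - 1), (Real.cos (a m j - a m i) : ℂ) := by
      intro i j
      have hreal : U (x j - x i) = κ * ∑ m ∈ range (N - 1), Real.cos (a m j - a m i) := by
        rw [hU]
        congr 1
        refine sum_congr rfl fun m _ => ?_
        rw [phase_sub]
      rw [hreal]
      push_cast
      rfl
    simp_rw [hUij]
    have hre : ∑ i, ∑ j, conj (c i) * c j * ((κ : ℂ) * ∑ m ∈ range (N - 1),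
        (Real.cos (a m j - a m i) : ℂ)) =
        (κ : ℂ) * ∑ m ∈ range (N - 1), ∑ i, ∑ j, conj (c i) * c j * (Real.cos (a m j - a m i) : ℂ) := by
      have step1 : ∀ i j, conj (c i) * c j * ((κ : ℂ) * ∑ m ∈ range (N - 1),
          (Real.cos (a m j - a m i) : ℂ)) =
          ∑ m ∈ range (N - 1), (κ : ℂ) * (conj (c i) * c j * (Real.cos (a m j - a m i) : ℂ)) := by
        intro i j
        rw [mul_sum, mul_sum]
        exact sum_congr rfl fun m _ => by ring
      calc ∑ i, ∑ j, conj (c i) * c j * ((κ : ℂ) * ∑ m ∈ range (N - 1),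
            (Real.cos (a m j - a m i) : ℂ))
          = ∑ i, ∑ j, ∑ m ∈ range (N - 1),
              (κ : ℂ) * (conj (c i) * c j * (Real.cos (a m j - a m i) : ℂ)) := by simp_rw [step1]
        _ = ∑ i, ∑ m ∈ range (N - 1), ∑ j,
              (κ : ℂ) * (conj (c i) * c j * (Real.cos (a m j - a m i) : ℂ)) :=
            sum_congr rfl fun i _ => sum_comm
        _ = ∑ m ∈ range (N - 1), ∑ i, ∑ j,
              (κ : ℂ) * (conj (c i) * c j * (Real.cos (a m j - a m i) : ℂ)) := sum_comm
        _ = (κ : ℂ) * ∑ m ∈ range (N - 1), ∑ i, ∑ j,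
              conj (c i) * c j * (Real.cos (a m j - a m i) : ℂ) := by
            rw [mul_sum]
            refine sum_congr rfl fun m _ => ?_
            rw [mul_sum]
            refine sum_congr rfl fun i _ => ?_
            rw [mul_sum]
    rw [hre]
    simp_rw [sum_sum_conj_mul_cos_sub]
    push_cast
    rfl
  rw [key]
  refine ⟨?_, by simp only [Complex.ofReal_im]⟩
  simp only [Complex.ofReal_re]
  exact mul_nonneg hκ0 (sum_nonneg fun m _ => div_nonneg
    (add_nonneg (Complex.normSq_nonneg _) (Complex.normSq_nonneg _)) (by norm_num))

/-! ### The discrete Fourier identity -/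

/-- `∑_{m=0}^{N-1} e^{2πi m d/N} = 0` for an integer `d` with `0 < |d| < N` (a nontrivial `N`-th root
of unity sums to zero over a full period). [folklore] -/
theorem sum_exp_two_pi_mul_div_eq_zero {d : ℤ} (hd0 : d ≠ 0) (hdN : |d| < N) :
    ∑ m ∈ range N, Complex.exp (2 * Real.pi * (m * d / N : ℝ) * Complex.I) = 0 := by
  have hNpos : 0 < N := by
    have := abs_nonneg d; omega
  have hN0 : (N : ℂ) ≠ 0 := by exact_mod_cast hNpos.ne'
  set ζ : ℂ := Complex.exp (2 * Real.pi * (d / N : ℝ) * Complex.I) with hζ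
  have hpow : ∀ m : ℕ, Complex.exp (2 * Real.pi * (m * d / N : ℝ) * Complex.I) = ζ ^ m := by
    intro m
    rw [hζ, ← Complex.exp_nat_mul]
    congr 1
    push_cast
    ring
  simp_rw [hpow]
  have hζ1 : ζ ≠ 1 := by
    intro h
    rw [hζ, Complex.exp_eq_one_iff] at h
    obtain ⟨n, hn⟩ := h
    have hI : (2 * Real.pi * Complex.I : ℂ) ≠ 0 := by
      simp [Real.pi_ne_zero, Complex.I_ne_zero]
    have hn' : ((d : ℝ) / N : ℝ) = (n : ℂ) := by
      have h2 : (((d : ℝ) / N : ℝ) - (n : ℂ)) * (2 * Real.pi * Complex.I) = 0 := by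
        linear_combination hn
      rcases mul_eq_zero.mp h2 with h3 | h3
      · exact sub_eq_zero.mp h3
      · exact absurd h3 hI
    have h' : ((d : ℝ) : ℂ) = (n : ℂ) * (N : ℂ) := by
      have : ((d : ℝ) / N : ℝ) = ((d : ℝ) : ℂ) / (N : ℂ) := by push_cast; ring
      rw [this, div_eq_iff hN0] at hn'
      exact hn'
    have h'' : d = n * N := by exact_mod_cast h'
    rcases eq_or_ne n 0 with hn0 | hn0
    · exact hd0 (by rw [h'', hn0, zero_mul])
    · have : (N : ℤ) ≤ |d| := by
        rw [h'', abs_mul, Nat.abs_cast]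
        exact le_mul_of_one_le_left (by positivity) (Int.one_le_abs hn0)
      omega
  have hζN : ζ ^ N = 1 := by
    rw [hζ, ← Complex.exp_nat_mul, Complex.exp_eq_one_iff]
    refine ⟨d, ?_⟩
    push_cast
    field_simp
  rw [geom_sum_eq hζ1, hζN, sub_self, zero_div]

/-- `∑_{m=0}^{N-1} cos(2π m d/N) = 0` for an integer `d` with `0 < |d| < N`. [folklore] -/
theorem sum_cos_two_pi_mul_div_eq_zero {d : ℤ} (hd0 : d ≠ 0) (hdN : |d| < N) :
    ∑ m ∈ range N, Real.cos (2 * Real.pi * (m * d / N : ℝ)) = 0 := by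
  have h := congrArg Complex.re (sum_exp_two_pi_mul_div_eq_zero hd0 hdN)
  rw [Complex.re_sum, Complex.zero_re] at h
  rw [← h]
  refine sum_congr rfl fun m _ => ?_
  rw [show (2 * Real.pi * (m * d / N : ℝ) : ℂ) * Complex.I =
      ((2 * Real.pi * (m * d / N) : ℝ) : ℂ) * Complex.I by push_cast; ring,
    Complex.exp_ofReal_mul_I_re]

/-- `∑_{m=1}^{N-1} cos(2π m d/N) = -1` for an integer `d` with `0 < |d| < N`: the harmonics
`1, …, N-1` of a nonzero residue add up to minus the missing zeroth one. [folklore] -/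
theorem sum_cos_succ_eq_neg_one {d : ℤ} (hd0 : d ≠ 0) (hdN : |d| < N) :
    ∑ m ∈ range (N - 1), Real.cos (2 * Real.pi * ((m + 1 : ℝ) * d / N)) = -1 := by
  have hNpos : 0 < N := by
    have := abs_nonneg d; omega
  have h := sum_cos_two_pi_mul_div_eq_zero hd0 hdN
  rw [show range N = range (N - 1 + 1) by rw [Nat.sub_add_cancel hNpos], sum_range_succ'] at h
  simp only [Nat.cast_zero, zero_mul, zero_div, mul_zero, Real.cos_zero] at h
  have h' : ∑ m ∈ range (N - 1), Real.cos (2 * Real.pi * ((m + 1 : ℝ) * d / N)) =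
      ∑ m ∈ range (N - 1), Real.cos (2 * Real.pi * (((m + 1 : ℕ) : ℝ) * d / N)) := by
    refine sum_congr rfl fun m _ => ?_
    push_cast
    ring_nf
  rw [h']
  linarith

/-! ### The kernel at differences of well points -/

/-- **Well estimate.** If `y₀` is within `a` of `c₀ ∈ {0, ½, -½}` and `y₁` within `a` of `d/N`
(`d` an integer, `0 < |d| < N`, `N ≥ 2`, `0 ≤ a`), then `U y = -ε u/(N-1) + O(u N a)` with
`ε = cos(2π c₀) = ±1`: precisely `|U y + ε u/(N-1)| ≤ 4π u N a`. [folklore] -/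
theorem abs_U_add_le (hu : 0 ≤ u) (hN : 2 ≤ N)
    (hU : ∀ y, U y = u / ((N : ℝ) - 1) *
      ∑ m ∈ range (N - 1), Real.cos (2 * Real.pi * (y 0 + (m + 1 : ℝ) * y 1)))
    {c₀ ε : ℝ} (hc : (c₀ = 0 ∧ ε = 1) ∨ (c₀ = 1 / 2 ∧ ε = -1) ∨ (c₀ = -1 / 2 ∧ ε = -1))
    {d : ℤ} (hd0 : d ≠ 0) (hdN : |d| < N) {a : ℝ} (ha : 0 ≤ a) (y : Space)
    (hy0 : |y 0 - c₀| ≤ a) (hy1 : |y 1 - d / N| ≤ a) :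
    |U y + ε * (u / ((N : ℝ) - 1))| ≤ 4 * Real.pi * u * N * a := by
  have hN1 : (0 : ℝ) < (N : ℝ) - 1 := by
    have : (2 : ℝ) ≤ N := by exact_mod_cast hN
    linarith
  have hNr : (1 : ℝ) ≤ N := by linarith
  -- the exact value at the well centres
  have hcentre : ∀ m : ℕ, Real.cos (2 * Real.pi * (c₀ + (m + 1 : ℝ) * (d / N))) =
      ε * Real.cos (2 * Real.pi * ((m + 1 : ℝ) * d / N)) := by
    intro m
    rcases hc with ⟨h0, h1⟩ | ⟨h0, h1⟩ | ⟨h0, h1⟩ <;> subst h0 <;> subst h1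
    · rw [zero_add, one_mul, mul_div_assoc]
    · rw [show 2 * Real.pi * (1 / 2 + (m + 1 : ℝ) * (d / N)) =
          2 * Real.pi * ((m + 1 : ℝ) * d / N) + Real.pi by ring, Real.cos_add_pi]
      ring
    · rw [show 2 * Real.pi * (-1 / 2 + (m + 1 : ℝ) * (d / N)) =
          2 * Real.pi * ((m + 1 : ℝ) * d / N) - Real.pi by ring, Real.cos_sub_pi]
      ring
  have hsum : ∑ m ∈ range (N - 1), Real.cos (2 * Real.pi * (c₀ + (m + 1 : ℝ) * (d / N))) = -ε := by
    simp_rw [hcentre]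
    rw [← mul_sum, sum_cos_succ_eq_neg_one hd0 hdN]
    ring
  -- termwise Lipschitz estimate
  have hterm : ∀ m ∈ range (N - 1),
      |Real.cos (2 * Real.pi * (y 0 + (m + 1 : ℝ) * y 1)) -
        Real.cos (2 * Real.pi * (c₀ + (m + 1 : ℝ) * (d / N)))| ≤ 4 * Real.pi * N * a := by
    intro m hm
    have hm' : (m + 1 : ℝ) ≤ N := by
      have : m + 1 ≤ N := by have := mem_range.mp hm; omega
      exact_mod_cast this
    refine (Real.abs_cos_sub_cos_le _ _).trans ?_
    rw [← mul_sub, abs_mul, abs_of_pos Real.two_pi_pos]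
    have h2 : |y 0 + (m + 1 : ℝ) * y 1 - (c₀ + (m + 1 : ℝ) * (d / N))| ≤ a + N * a := by
      rw [show y 0 + (m + 1 : ℝ) * y 1 - (c₀ + (m + 1 : ℝ) * (d / N)) =
          (y 0 - c₀) + (m + 1 : ℝ) * (y 1 - d / N) by ring]
      refine (abs_add_le _ _).trans (add_le_add hy0 ?_)
      rw [abs_mul, abs_of_nonneg (by positivity)]
      exact mul_le_mul hm' hy1 (abs_nonneg _) (by positivity)
    calc 2 * Real.pi * |y 0 + (m + 1 : ℝ) * y 1 - (c₀ + (m + 1 : ℝ) * (d / N))|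
        ≤ 2 * Real.pi * (a + N * a) := by gcongr
      _ ≤ 4 * Real.pi * N * a := by
          have h0 : 0 ≤ Real.pi * a * ((N : ℝ) - 1) :=
            mul_nonneg (mul_nonneg Real.pi_pos.le ha) (by linarith)
          nlinarith [h0]
  -- assemble
  rw [hU]
  have hdiff : u / ((N : ℝ) - 1) * ∑ m ∈ range (N - 1), Real.cos (2 * Real.pi * (y 0 + (m + 1 : ℝ) * y 1)) +
      ε * (u / ((N : ℝ) - 1)) =
      u / ((N : ℝ) - 1) * ∑ m ∈ range (N - 1), (Real.cos (2 * Real.pi * (y 0 + (m + 1 : ℝ) * y 1)) -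
        Real.cos (2 * Real.pi * (c₀ + (m + 1 : ℝ) * (d / N)))) := by
    rw [sum_sub_distrib, hsum]
    ring
  rw [hdiff, abs_mul, abs_div, abs_of_nonneg hu, abs_of_pos hN1]
  calc u / ((N : ℝ) - 1) * |∑ m ∈ range (N - 1), (Real.cos (2 * Real.pi * (y 0 + (m + 1 : ℝ) * y 1)) -
        Real.cos (2 * Real.pi * (c₀ + (m + 1 : ℝ) * (d / N))))|
      ≤ u / ((N : ℝ) - 1) * ∑ m ∈ range (N - 1), |Real.cos (2 * Real.pi * (y 0 + (m + 1 : ℝ) * y 1)) -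
        Real.cos (2 * Real.pi * (c₀ + (m + 1 : ℝ) * (d / N)))| := by
        gcongr
        exact abs_sum_le_sum_abs _ _
    _ ≤ u / ((N : ℝ) - 1) * ∑ _m ∈ range (N - 1), 4 * Real.pi * N * a := by
        gcongr with m hm
        exact hterm m hm
    _ = 4 * Real.pi * u * N * a := by
        rw [sum_const, card_range, nsmul_eq_mul, Nat.cast_sub (by omega), Nat.cast_one, ← mul_assoc,
          div_mul_cancel₀ u hN1.ne']
        ring

end Summit.AtomisticToContinuum.BoseEinsteinCondensation.Theorems.PosdefDressingNeg

end
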